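import Literature.Probability.LatticeModels.KCTwoPointLayer
import Literature.Probability.LatticeModels.KCSectionFamilyBoundaryHb
import HarnessLib

/-!
# The sup of the Kadanoff–Ceva primitive of the two-point family away from the marked points

Topic `Literature/Probability/LatticeModels`. Chelkak–Hongler–Izyurov 2015, proof of Thm 2.16 (§3.4,
"It remains to justify the uniform boundedness of `H_δ` away from `a, a₁, …`") and Lemma 3.10, for
the two-point family `twoPointFamily Ω a b` (`KCTwoPointFamily.lean`), on the lattice:

* `frozenVal` — the common value `c_δ` of `Hw` on the frozen corners (Dirichlet normalisation);
* `regionW`/`regionB δ R` — the free sites / touching plaquettes outside the two lattice boxes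
  `sqBox p₀ R`, `sqBox b̂ R` (`p₀ = sourcePlaq δ a`, `b̂ = nearestSite δ b`); `supDev δ R = 𝓜_δ(R)` —
  the max of `|H - c_δ|` over them; `layerDev δ R` — the max over the cells of the two layers
  `sqBox ĉ R ∖ sqBox ĉ (R - 1)`;
* **`supDev_le_max_layerDev`** (CHI: "`z^max` belongs to one of the discrete circles"): if `Hw ≥ c - η'`
  and `Hb ≤ c + η'` on the `d`-collar of `∂Ω` and the `d/2`-deep sites are in the component volume,
  then `𝓜_δ(R) ≤ max(η', layerDev δ R)` — by the minimum principle for the superharmonic `Hw` and the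
  maximum principle for the subharmonic `Hb` on the deep part of the region, plus `Hw ≤ Hb`.

Everything is proved; no named fact. (The iteration with `KCTwoPointLayer` and the resulting a-priori
bounds are in the sequel.)

## References

* D. Chelkak, C. Hongler, K. Izyurov, Ann. of Math. 181 (2015), §3.4 (proof of Thm 2.16) and
  Lemma 3.10 [ChelkakHonglerIzyurovAnnals2015].
-/

noncomputable section

namespace Literature.Probability.LatticeModels

open Complex Filter Metric Set _root_.Topology Finset SimpleGraph WeakBeurling

variable (Ω : Set ℂ) (a b : ℂ) (δ : ℝ)

/-! ### The frozen value -/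

open scoped Classical in
/-- **The frozen value `c_δ`**: the common value of `Hw` on the frozen corners of the system (`0` if
there are none). [cite: ChelkakHonglerIzyurovAnnals2015, Prop. 3.6 (Dirichlet normalisation)] -/
def frozenVal : ℝ :=
  if h : ∃ v : Site 2, v ∉ compVol Ω a δ ∧ ∃ k : Fin 4, faceAt v k ∈ fillFinset (touchPlaquettes (compVol Ω a δ)) then
    (twoPointFamily Ω a b).Hw δ h.choose else 0

variable {Ω a b δ} in
/-- At a good scale, `Hw = c_δ` on every frozen corner. [cite: ChelkakHonglerIzyurovAnnals2015, Prop. 3.6] -/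
theorem hw_eq_frozenVal (hgood : GoodScale Ω a δ) {v : Site 2} {k : Fin 4} (hv : v ∉ compVol Ω a δ)
    (hk : faceAt v k ∈ fillFinset (touchPlaquettes (compVol Ω a δ))) :
    (twoPointFamily Ω a b).Hw δ v = frozenVal Ω a b δ := by
  classical
  have hex : ∃ v : Site 2, v ∉ compVol Ω a δ ∧ ∃ k : Fin 4, faceAt v k ∈ fillFinset (touchPlaquettes (compVol Ω a δ)) :=
    ⟨v, hv, k, hk⟩
  rw [frozenVal, dif_pos hex]
  obtain ⟨hv', k', hk'⟩ := hex.choose_spec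
  have h5 := (twoPointData_spec b hgood).2.2.2.2
  rw [twoPointFamily_Hw]
  exact (h5 _ _ _ _ hv' hk' hv hk)

/-! ### Regions, layers and their maxima -/

open scoped Classical in
/-- The free sites outside the two boxes of radius `R`. [cite: ChelkakHonglerIzyurovAnnals2015, §3.4 (Ω_δ(ε))] -/
def regionW (R : ℕ) : Finset (Site 2) :=
  (compVol Ω a δ).filter fun v => v ∉ sqBox (sourcePlaq δ a) R ∧ v ∉ sqBox (nearestSite δ b) R

open scoped Classical in
/-- The touching plaquettes outside the two boxes of radius `R`. [cite: ChelkakHonglerIzyurovAnnals2015, §3.4 (Ω_δ(ε))] -/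
def regionB (R : ℕ) : Finset (Site 2) :=
  (touchPlaquettes (compVol Ω a δ)).filter fun f => f ∉ sqBox (sourcePlaq δ a) R ∧ f ∉ sqBox (nearestSite δ b) R

/-- **The two layers of radius `R`**: `sqBox ĉ R ∖ sqBox ĉ (R - 1)`, `ĉ ∈ {p₀, b̂}`, as a predicate. [cite: ChelkakHonglerIzyurovAnnals2015, proof of Lemma 3.10 (the discrete circles ℓ(ε))] -/
def InLayer (y : Site 2) (R : ℕ) : Prop :=
  (y ∈ sqBox (sourcePlaq δ a) R ∧ y ∉ sqBox (sourcePlaq δ a) ((R : ℤ) - 1)) ∨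
    (y ∈ sqBox (nearestSite δ b) R ∧ y ∉ sqBox (nearestSite δ b) ((R : ℤ) - 1))

open scoped Classical in
/-- The free sites of the two layers. [folklore] -/
def layerW (R : ℕ) : Finset (Site 2) := (compVol Ω a δ).filter fun v => InLayer a b δ v R

open scoped Classical in
/-- The touching plaquettes of the two layers. [folklore] -/
def layerB (R : ℕ) : Finset (Site 2) := (touchPlaquettes (compVol Ω a δ)).filter fun f => InLayer a b δ f R

/-- **`𝓜_δ(R)`**: the max of `|Hw - c_δ|` over `regionW` and of `|Hb - c_δ|` over `regionB`. [cite: ChelkakHonglerIzyurovAnnals2015, §3.4 (M_δ(ε))] -/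
def supDev (R : ℕ) : ℝ :=
  ((((regionW Ω a b δ R).sup fun v => Real.toNNReal |(twoPointFamily Ω a b).Hw δ v - frozenVal Ω a b δ|) ⊔
    ((regionB Ω a b δ R).sup fun f => Real.toNNReal |(twoPointFamily Ω a b).Hb δ f - frozenVal Ω a b δ|) : NNReal) : ℝ)

/-- **The layer max**: the max of `|Hw - c_δ|` over the free sites and of `|Hb - c_δ|` over the
touching plaquettes in the two layers of radius `R`. [cite: ChelkakHonglerIzyurovAnnals2015, proof of Lemma 3.10] -/
def layerDev (R : ℕ) : ℝ :=
  ((((layerW Ω a b δ R).sup fun v => Real.toNNReal |(twoPointFamily Ω a b).Hw δ v - frozenVal Ω a b δ|) ⊔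
    ((layerB Ω a b δ R).sup fun f => Real.toNNReal |(twoPointFamily Ω a b).Hb δ f - frozenVal Ω a b δ|) : NNReal) : ℝ)

variable {Ω a b δ}

/-- Membership in `regionW`. [folklore] -/
theorem mem_regionW {R : ℕ} {v : Site 2} :
    v ∈ regionW Ω a b δ R ↔ v ∈ compVol Ω a δ ∧ v ∉ sqBox (sourcePlaq δ a) R ∧ v ∉ sqBox (nearestSite δ b) R := by
  classical
  rw [regionW, Finset.mem_filter]

/-- Membership in `regionB`. [folklore] -/
theorem mem_regionB {R : ℕ} {f : Site 2} :
    f ∈ regionB Ω a b δ R ↔ f ∈ touchPlaquettes (compVol Ω a δ) ∧ f ∉ sqBox (sourcePlaq δ a) R ∧ f ∉ sqBox (nearestSite δ b) R := by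
  classical
  rw [regionB, Finset.mem_filter]

/-- Membership in `layerW`. [folklore] -/
theorem mem_layerW {R : ℕ} {v : Site 2} : v ∈ layerW Ω a b δ R ↔ v ∈ compVol Ω a δ ∧ InLayer a b δ v R := by
  classical
  rw [layerW, Finset.mem_filter]

/-- Membership in `layerB`. [folklore] -/
theorem mem_layerB {R : ℕ} {f : Site 2} : f ∈ layerB Ω a b δ R ↔ f ∈ touchPlaquettes (compVol Ω a δ) ∧ InLayer a b δ f R := by
  classical
  rw [layerB, Finset.mem_filter]

/-- A generic bound: the real value of a finite sup of `toNNReal |·|`. [folklore] -/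
theorem le_coe_sup_toNNReal {ι : Type*} {s : Finset ι} (g : ι → ℝ) {i : ι} (hi : i ∈ s) :
    |g i| ≤ ((s.sup fun j => Real.toNNReal |g j| : NNReal) : ℝ) := by
  have h : Real.toNNReal |g i| ≤ s.sup fun j => Real.toNNReal |g j| := Finset.le_sup (f := fun j => Real.toNNReal |g j|) hi
  have := NNReal.coe_le_coe.2 h
  rwa [Real.coe_toNNReal _ (abs_nonneg _)] at this

/-- A generic bound: a finite sup of `toNNReal |·|` is at most a common bound. [folklore] -/
theorem coe_sup_toNNReal_le {ι : Type*} {s : Finset ι} (g : ι → ℝ) {m : ℝ} (hm : 0 ≤ m) (h : ∀ i ∈ s, |g i| ≤ m) :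
    ((s.sup fun j => Real.toNNReal |g j| : NNReal) : ℝ) ≤ m := by
  have : (s.sup fun j => Real.toNNReal |g j|) ≤ Real.toNNReal m :=
    Finset.sup_le fun i hi => Real.toNNReal_le_toNNReal (h i hi)
  have := NNReal.coe_le_coe.2 this
  rwa [Real.coe_toNNReal _ hm] at this

/-- `𝓜(R) ≥ 0`. [folklore] -/
theorem supDev_nonneg (R : ℕ) : 0 ≤ supDev Ω a b δ R := NNReal.coe_nonneg _

/-- `layerDev ≥ 0`. [folklore] -/
theorem layerDev_nonneg (R : ℕ) : 0 ≤ layerDev Ω a b δ R := NNReal.coe_nonneg _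

/-- `|Hw v - c| ≤ 𝓜(R)` on `regionW`. [folklore] -/
theorem abs_hw_le_supDev {R : ℕ} {v : Site 2} (hv : v ∈ regionW Ω a b δ R) :
    |(twoPointFamily Ω a b).Hw δ v - frozenVal Ω a b δ| ≤ supDev Ω a b δ R := by
  refine (le_coe_sup_toNNReal (fun v => (twoPointFamily Ω a b).Hw δ v - frozenVal Ω a b δ) hv).trans ?_
  exact NNReal.coe_le_coe.2 le_sup_left

/-- `|Hb f - c| ≤ 𝓜(R)` on `regionB`. [folklore] -/
theorem abs_hb_le_supDev {R : ℕ} {f : Site 2} (hf : f ∈ regionB Ω a b δ R) :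
    |(twoPointFamily Ω a b).Hb δ f - frozenVal Ω a b δ| ≤ supDev Ω a b δ R := by
  refine (le_coe_sup_toNNReal (fun f => (twoPointFamily Ω a b).Hb δ f - frozenVal Ω a b δ) hf).trans ?_
  exact NNReal.coe_le_coe.2 le_sup_right

/-- `𝓜(R) ≤ m` from bounds on the two regions. [folklore] -/
theorem supDev_le {R : ℕ} {m : ℝ} (hm : 0 ≤ m)
    (hW : ∀ v ∈ regionW Ω a b δ R, |(twoPointFamily Ω a b).Hw δ v - frozenVal Ω a b δ| ≤ m)
    (hB : ∀ f ∈ regionB Ω a b δ R, |(twoPointFamily Ω a b).Hb δ f - frozenVal Ω a b δ| ≤ m) :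
    supDev Ω a b δ R ≤ m := by
  rw [supDev, NNReal.coe_max]
  exact max_le (coe_sup_toNNReal_le _ hm hW) (coe_sup_toNNReal_le _ hm hB)

/-- `|Hw v - c| ≤ layerDev` for a free site of a layer. [folklore] -/
theorem abs_hw_le_layerDev {R : ℕ} {v : Site 2} (hv : v ∈ compVol Ω a δ) (hvl : InLayer a b δ v R) :
    |(twoPointFamily Ω a b).Hw δ v - frozenVal Ω a b δ| ≤ layerDev Ω a b δ R := by
  refine (le_coe_sup_toNNReal (fun v => (twoPointFamily Ω a b).Hw δ v - frozenVal Ω a b δ)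
    (mem_layerW.2 ⟨hv, hvl⟩)).trans ?_
  exact NNReal.coe_le_coe.2 le_sup_left

/-- `|Hb f - c| ≤ layerDev` for a touching plaquette of a layer. [folklore] -/
theorem abs_hb_le_layerDev {R : ℕ} {f : Site 2} (hf : f ∈ touchPlaquettes (compVol Ω a δ)) (hfl : InLayer a b δ f R) :
    |(twoPointFamily Ω a b).Hb δ f - frozenVal Ω a b δ| ≤ layerDev Ω a b δ R := by
  refine (le_coe_sup_toNNReal (fun f => (twoPointFamily Ω a b).Hb δ f - frozenVal Ω a b δ)
    (mem_layerB.2 ⟨hf, hfl⟩)).trans ?_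
  exact NNReal.coe_le_coe.2 le_sup_right

/-- The layer max is attained (or is `0`): there is a free site or a touching plaquette of a layer
at which `|H - c| = layerDev`, provided `layerDev > 0`. [folklore] -/
theorem exists_cell_layerDev {R : ℕ} (hpos : 0 < layerDev Ω a b δ R) :
    (∃ v ∈ compVol Ω a δ, InLayer a b δ v R ∧ |(twoPointFamily Ω a b).Hw δ v - frozenVal Ω a b δ| = layerDev Ω a b δ R) ∨
    (∃ f ∈ touchPlaquettes (compVol Ω a δ), InLayer a b δ f R ∧
      |(twoPointFamily Ω a b).Hb δ f - frozenVal Ω a b δ| = layerDev Ω a b δ R) := by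
  classical
  rw [layerDev, NNReal.coe_max] at hpos ⊢
  set sW := layerW Ω a b δ R
  set sB := layerB Ω a b δ R
  set gW : Site 2 → NNReal := fun v => Real.toNNReal |(twoPointFamily Ω a b).Hw δ v - frozenVal Ω a b δ|
  set gB : Site 2 → NNReal := fun f => Real.toNNReal |(twoPointFamily Ω a b).Hb δ f - frozenVal Ω a b δ|
  rcases le_total (sB.sup gB) (sW.sup gW) with h | h
  · -- the white sup dominates
    have hmax : max ((sW.sup gW : NNReal) : ℝ) ((sB.sup gB : NNReal) : ℝ) = ((sW.sup gW : NNReal) : ℝ) :=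
      max_eq_left (NNReal.coe_le_coe.2 h)
    rw [hmax] at hpos ⊢
    have hne : sW.Nonempty := by
      by_contra hne
      rw [Finset.not_nonempty_iff_eq_empty] at hne
      rw [hne, Finset.sup_empty] at hpos
      simp at hpos
    obtain ⟨v, hv, hvmax⟩ := Finset.exists_mem_eq_sup sW hne gW
    refine Or.inl ⟨v, (mem_layerW.1 hv).1, (mem_layerW.1 hv).2, ?_⟩
    rw [hvmax]
    exact (Real.coe_toNNReal _ (abs_nonneg _)).symm
  · have hmax : max ((sW.sup gW : NNReal) : ℝ) ((sB.sup gB : NNReal) : ℝ) = ((sB.sup gB : NNReal) : ℝ) :=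
      max_eq_right (NNReal.coe_le_coe.2 h)
    rw [hmax] at hpos ⊢
    have hne : sB.Nonempty := by
      by_contra hne
      rw [Finset.not_nonempty_iff_eq_empty] at hne
      rw [hne, Finset.sup_empty] at hpos
      simp at hpos
    obtain ⟨f, hf, hfmax⟩ := Finset.exists_mem_eq_sup sB hne gB
    refine Or.inr ⟨f, (mem_layerB.1 hf).1, (mem_layerB.1 hf).2, ?_⟩
    rw [hfmax]
    exact (Real.coe_toNNReal _ (abs_nonneg _)).symm

/-! ### Lattice geometry helpers -/

/-- A lattice neighbour of a site outside `sqBox c R` which lies in `sqBox c R` lies in the layer. [folklore] -/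
theorem mem_layer_of_adj {c v : Site 2} {R : ℕ} (hv : v ∉ sqBox c R) {k : Fin 4} (hw : v + cornerUnit k ∈ sqBox c R) :
    v + cornerUnit k ∈ sqBox c R ∧ v + cornerUnit k ∉ sqBox c ((R : ℤ) - 1) := by
  refine ⟨hw, fun h => hv ?_⟩
  have := add_cornerUnit_mem_sqBox h (k + 2)
  rwa [sub_add_cancel, cornerUnit_add_two, add_neg_cancel_right] at this

/-- A corner of a plaquette outside `sqBox c R` which lies in `sqBox c R` lies in the layer. [folklore] -/
theorem mem_layer_of_cornerOff {c f : Site 2} {R : ℕ} (hf : f ∉ sqBox c R) {j : Fin 4} (hw : f + cornerOff j ∈ sqBox c R) :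
    f + cornerOff j ∈ sqBox c R ∧ f + cornerOff j ∉ sqBox c ((R : ℤ) - 1) := by
  refine ⟨hw, fun h => hf ?_⟩
  have := faceAt_mem_sqBox h j
  rwa [sub_add_cancel, faceAt_add_cornerOff] at this

/-- A lattice neighbour (as a plaquette) of a plaquette outside `sqBox c R` which lies in `sqBox c R`
lies in the layer. [folklore] -/
theorem mem_layer_of_adj' {c f : Site 2} {R : ℕ} (hf : f ∉ sqBox c R) {k : Fin 4} (hw : f + cornerUnit k ∈ sqBox c R) :
    f + cornerUnit k ∈ sqBox c R ∧ f + cornerUnit k ∉ sqBox c ((R : ℤ) - 1) :=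
  mem_layer_of_adj hf hw

/-- Mesh points of lattice neighbours are `2δ`-close, hence `infDist` to `Ωᶜ` drops by at most `2δ`. [folklore] -/
theorem infDist_add_cornerUnit_ge {Ω : Set ℂ} {δ : ℝ} (hδ : 0 ≤ δ) (v : Site 2) (k : Fin 4) :
    infDist (meshPoint δ v) Ωᶜ - 2 * δ ≤ infDist (meshPoint δ (v + cornerUnit k)) Ωᶜ := by
  have h1 := dist_meshPoint_add_le hδ v (cornerUnit k) (abs_cornerUnit_apply_le_one k 0) (abs_cornerUnit_apply_le_one k 1)
  have h2 := Metric.infDist_le_infDist_add_dist (s := Ωᶜ) (x := meshPoint δ v) (y := meshPoint δ (v + cornerUnit k))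
  rw [_root_.dist_comm] at h2
  linarith

/-- The same for the corners of a plaquette. [folklore] -/
theorem infDist_add_cornerOff_ge {Ω : Set ℂ} {δ : ℝ} (hδ : 0 ≤ δ) (f : Site 2) (j : Fin 4) :
    infDist (meshPoint δ f) Ωᶜ - 2 * δ ≤ infDist (meshPoint δ (f + cornerOff j)) Ωᶜ := by
  have h1 := dist_meshPoint_add_le hδ f (cornerOff j) (abs_cornerOff_apply_le j 0) (abs_cornerOff_apply_le j 1)
  have h2 := Metric.infDist_le_infDist_add_dist (s := Ωᶜ) (x := meshPoint δ f) (y := meshPoint δ (f + cornerOff j))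
  rw [_root_.dist_comm] at h2
  linarith

/-- The centre is in its box. [folklore] -/
theorem self_mem_sqBox' (c : Site 2) (R : ℕ) : c ∈ sqBox c R := by
  simp [mem_sqBox]

/-! ### The localisation of the sup (CHI: `z^max` is on one of the discrete circles) -/

/-- **The sup of `|H - c_δ|` away from the marked points is controlled by the layers** (Chelkak–
Hongler–Izyurov 2015, proof of Lemma 3.10: "by sub- and super-harmonicity of `H°` and `H•`,
`z^max_δ` belongs to one of the discrete circles (recall that `H_δ` vanishes on the boundary)"; in
the tree's setting the boundary values are `Hw = c_δ` exactly and `Hb ≤ c_δ + η'`, `Hw ≥ c_δ - η'` on a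
`d`-collar): `𝓜_δ(R) ≤ max(η', layerDev δ R)`. [cite: ChelkakHonglerIzyurovAnnals2015, proof of Lemma 3.10 and Remark 3.7] -/
theorem supDev_le_max_layerDev {δ : ℝ} (hδ : 0 < δ) (hgood : GoodScale Ω a δ) (R : ℕ) {d η' : ℝ} (hη' : 0 ≤ η')
    (hδd : 8 * δ ≤ d)
    (hdeep : ∀ w : Site 2, d / 2 ≤ infDist (meshPoint δ w) Ωᶜ → w ∈ compVol Ω a δ)
    (hcolW : ∀ v ∈ compVol Ω a δ, infDist (meshPoint δ v) Ωᶜ ≤ d →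
      frozenVal Ω a b δ - η' ≤ (twoPointFamily Ω a b).Hw δ v)
    (hcolB : ∀ f ∈ touchPlaquettes (compVol Ω a δ), infDist (meshPoint δ f) Ωᶜ ≤ d →
      (twoPointFamily Ω a b).Hb δ f ≤ frozenVal Ω a b δ + η') :
    supDev Ω a b δ R ≤ max η' (layerDev Ω a b δ R) := by
  classical
  obtain ⟨hcuts, h0, hodd, hprim, -⟩ := twoPointData_spec b hgood
  rw [← twoPointFamily_cut] at hcuts h0 hodd hprim
  rw [← twoPointFamily_Hw, ← twoPointFamily_Hb] at hprim
  have hG : ∀ v ∈ compVol Ω a δ, ∀ k : Fin 4, (discreteDomainGraph Ω δ).Adj v (v + cornerUnit k) := fun v hv k => compVol_adj hv k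
  have hle := discreteDomainGraph_le_zdGraph Ω δ
  set c := frozenVal Ω a b δ with hc
  set L := layerDev Ω a b δ R with hL
  set m := max η' L with hm
  have hL0 : 0 ≤ L := layerDev_nonneg R
  have hm0 : 0 ≤ m := le_max_of_le_left hη'
  have hηm : η' ≤ m := le_max_left _ _
  have hLm : L ≤ m := le_max_right _ _
  have hp₀box : sourcePlaq δ a ∈ sqBox (sourcePlaq δ a) R := self_mem_sqBox' _ _
  have hbbox : nearestSite δ b ∈ sqBox (nearestSite δ b) R := self_mem_sqBox' _ _
  -- layer cells are within `m` of `c`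
  have hlayW : ∀ w ∈ compVol Ω a δ, InLayer a b δ w R → c - m ≤ (twoPointFamily Ω a b).Hw δ w ∧ (twoPointFamily Ω a b).Hw δ w ≤ c + m := by
    intro w hw hwl
    have := abs_hw_le_layerDev hw hwl
    rw [abs_le] at this; constructor <;> linarith
  have hlayB : ∀ g ∈ touchPlaquettes (compVol Ω a δ), InLayer a b δ g R → (twoPointFamily Ω a b).Hb δ g ≤ c + m := by
    intro g hg hgl
    have := abs_hb_le_layerDev hg hgl
    rw [abs_le] at this; linarith
  -- (W) the lower bound for `Hw` on the white region
  have hWlow : ∀ v ∈ regionW Ω a b δ R, c - m ≤ (twoPointFamily Ω a b).Hw δ v := by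
    obtain ⟨T, hT⟩ : ∃ T : Set (Site 2), T = {v | v ∈ regionW Ω a b δ R ∧ d < infDist (meshPoint δ v) Ωᶜ} := ⟨_, rfl⟩
    have hTfin : T.Finite := by
      rw [hT]; exact (regionW Ω a b δ R).finite_toSet.subset fun v hv => hv.1
    have hsup : IsLatticeSuperharmonicOn ((twoPointFamily Ω a b).Hw δ) T := by
      intro v hv
      rw [hT] at hv
      obtain ⟨hvΛ, -, hvb⟩ := mem_regionW.1 hv.1
      exact hprim.latticeLaplacian_white_nonpos_of_mem _ hG hle hcuts hvΛ (by
        rw [Finset.mem_singleton]; rintro rfl; exact hvb hbbox)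
    have hbd : ∀ w ∈ latticeOuterBoundary T, c - m ≤ (twoPointFamily Ω a b).Hw δ w := by
      rintro w ⟨hwT, v, hv, k, rfl⟩
      rw [hT] at hv hwT
      obtain ⟨hvR, hvd⟩ := hv
      obtain ⟨hvΛ, hvp, hvb⟩ := mem_regionW.1 hvR
      have hwd : d / 2 ≤ infDist (meshPoint δ (v + cornerUnit k)) Ωᶜ := by
        have := infDist_add_cornerUnit_ge (Ω := Ω) hδ.le v k; linarith
      have hwΛ : v + cornerUnit k ∈ compVol Ω a δ := hdeep _ hwd
      by_cases hwp : v + cornerUnit k ∈ sqBox (sourcePlaq δ a) R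
      · exact (hlayW _ hwΛ (Or.inl (mem_layer_of_adj hvp hwp))).1
      by_cases hwb : v + cornerUnit k ∈ sqBox (nearestSite δ b) R
      · exact (hlayW _ hwΛ (Or.inr (mem_layer_of_adj hvb hwb))).1
      have hwR : v + cornerUnit k ∈ regionW Ω a b δ R := mem_regionW.2 ⟨hwΛ, hwp, hwb⟩
      have hwd' : infDist (meshPoint δ (v + cornerUnit k)) Ωᶜ ≤ d := by
        by_contra hlt; exact hwT ⟨hwR, lt_of_not_ge hlt⟩
      linarith [hcolW _ hwΛ hwd']
    have key := hsup.ge_of_forall_boundary_ge hTfin hbd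
    intro v hv
    by_cases hvd : d < infDist (meshPoint δ v) Ωᶜ
    · exact key v (by rw [hT]; exact ⟨hv, hvd⟩)
    · linarith [hcolW v (mem_regionW.1 hv).1 (le_of_not_gt hvd)]
  -- (B) the upper bound for `Hb` on the black region
  have hBup : ∀ f ∈ regionB Ω a b δ R, (twoPointFamily Ω a b).Hb δ f ≤ c + m := by
    obtain ⟨T, hT⟩ : ∃ T : Set (Site 2), T = {f | f ∈ regionB Ω a b δ R ∧ d < infDist (meshPoint δ f) Ωᶜ} := ⟨_, rfl⟩
    have hTfin : T.Finite := by
      rw [hT]; exact (regionB Ω a b δ R).finite_toSet.subset fun f hf => hf.1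
    have hsub : IsLatticeSubharmonicOn ((twoPointFamily Ω a b).Hb δ) T := by
      intro f hf
      rw [hT] at hf
      obtain ⟨hfR, hfd⟩ := hf
      obtain ⟨hft, hfp, -⟩ := mem_regionB.1 hfR
      have hcorn : ∀ j : Fin 4, f + cornerOff j ∈ compVol Ω a δ := fun j =>
        hdeep _ (by have := infDist_add_cornerOff_ge (Ω := Ω) hδ.le f j; linarith)
      refine hprim.latticeLaplacian_black_nonneg hcuts (Finset.mem_coe.2 (subset_fillFinset _ hft)) (fun j => ?_)
        (sides_mem_edgesTouching hcorn) (hodd f hft (by rintro rfl; exact hfp hp₀box))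
      rw [← faceAt_face_corner_add_three f j]
      exact faceAt_mem_P (hcorn j) _
    have hbd : ∀ g ∈ latticeOuterBoundary T, (twoPointFamily Ω a b).Hb δ g ≤ c + m := by
      rintro g ⟨hgT, f, hf, k, rfl⟩
      rw [hT] at hf hgT
      obtain ⟨hfR, hfd⟩ := hf
      obtain ⟨hft, hfp, hfb⟩ := mem_regionB.1 hfR
      have hgd : d / 2 ≤ infDist (meshPoint δ (f + cornerUnit k)) Ωᶜ := by
        have := infDist_add_cornerUnit_ge (Ω := Ω) hδ.le f k; linarith
      have hgΛ : f + cornerUnit k ∈ compVol Ω a δ := hdeep _ hgd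
      have hgt : f + cornerUnit k ∈ touchPlaquettes (compVol Ω a δ) := by
        simpa [faceAt_zero_eq] using faceAt_mem_touchPlaquettes hgΛ 0
      by_cases hgp : f + cornerUnit k ∈ sqBox (sourcePlaq δ a) R
      · exact hlayB _ hgt (Or.inl (mem_layer_of_adj hfp hgp))
      by_cases hgb : f + cornerUnit k ∈ sqBox (nearestSite δ b) R
      · exact hlayB _ hgt (Or.inr (mem_layer_of_adj hfb hgb))
      have hgR : f + cornerUnit k ∈ regionB Ω a b δ R := mem_regionB.2 ⟨hgt, hgp, hgb⟩
      have hgd' : infDist (meshPoint δ (f + cornerUnit k)) Ωᶜ ≤ d := by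
        by_contra hlt; exact hgT ⟨hgR, lt_of_not_ge hlt⟩
      linarith [hcolB _ hgt hgd']
    have key := hsub.le_of_forall_boundary_le hTfin hbd
    intro f hf
    by_cases hfd : d < infDist (meshPoint δ f) Ωᶜ
    · exact key f (by rw [hT]; exact ⟨hf, hfd⟩)
    · linarith [hcolB f (mem_regionB.1 hf).1 (le_of_not_gt hfd)]
  -- (C) combine with `Hw ≤ Hb`
  refine supDev_le hm0 (fun v hv => ?_) (fun f hf => ?_)
  · obtain ⟨hvΛ, hvp, hvb⟩ := mem_regionW.1 hv
    have hvt : v ∈ touchPlaquettes (compVol Ω a δ) := by simpa [faceAt_zero_eq] using faceAt_mem_touchPlaquettes hvΛ 0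
    have hwb : (twoPointFamily Ω a b).Hw δ v ≤ (twoPointFamily Ω a b).Hb δ v := by
      have := hprim.hw_le_hb _ (faceAt_mem_P hvΛ 0)
      rwa [faceAt_zero_eq] at this
    have h1 := hWlow v hv
    have h2 := hBup v (mem_regionB.2 ⟨hvt, hvp, hvb⟩)
    rw [abs_le]; constructor <;> linarith
  · obtain ⟨hft, hfp, hfb⟩ := mem_regionB.1 hf
    obtain ⟨v, hvΛ, k, hvk⟩ := mem_touchPlaquettes.1 hft
    have hv : v = f + cornerOff k := by rw [← hvk, faceAt, sub_add_cancel]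
    have hwb : (twoPointFamily Ω a b).Hw δ v ≤ (twoPointFamily Ω a b).Hb δ f := by
      have := hprim.hw_le_hb _ (faceAt_mem_P hvΛ k)
      rwa [hvk] at this
    have h1 : c - m ≤ (twoPointFamily Ω a b).Hw δ v := by
      by_cases hvp : v ∈ sqBox (sourcePlaq δ a) R
      · rw [hv] at hvp ⊢
        exact (hlayW _ (hv ▸ hvΛ) (Or.inl (mem_layer_of_cornerOff hfp hvp))).1
      by_cases hvb : v ∈ sqBox (nearestSite δ b) R
      · rw [hv] at hvb ⊢
        exact (hlayW _ (hv ▸ hvΛ) (Or.inr (mem_layer_of_cornerOff hfb hvb))).1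
      exact hWlow v (mem_regionW.2 ⟨hvΛ, hvp, hvb⟩)
    have h2 := hBup f hf
    rw [abs_le]; constructor <;> linarith

end Literature.Probability.LatticeModels
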